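import Literature.AlgebraicGeometry.HodgeTheory.SemiregularVariationalHodge
import Literature.AlgebraicGeometry.HodgeTheory.SemiregularityHigherSigma
import HarnessLib

/-!
# Perry's semiregularity theorem with the FULL Buchweitz–Flenner semiregularity map (named fact)

Family `hodge`, layer `Literature/AlgebraicGeometry/HodgeTheory`. The tree's named fact
`HodgeTheory.Perry2026_semiregular_remainsAlgebraic` (`SemiregularVariationalHodge.lean`) renders
[Perry2026Semiregularity, Thm. 1.1 (2)] with the hypothesis "`E_0` is `{0,1}`-semiregular"
(`IsZeroOneSemiregular`: the part `(σ_0, σ_1)` of the semiregularity map is injective) because, when it was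
filed, only `σ_0`, `σ_1` had carriers in the tree ("`Ω^q` for `q ≥ 2` awaits `defn-HodgeSheavesOmega`").
Since `HodgeTheory/SemiregularityHigherSigma.lean` the tree CONSTRUCTS every component
`σ_q = Tr(· ∘ At(E)^q) : Ext²(E, E) → H^{q+2}(X, Ω^q_{X/S})` (`sigmaHigher`) and the notion
`IsISemiregular hE I` ("`(σ_q)_{q ∈ I}` jointly injective", BF §5), with the PROVED comparisons
`hodgeCohomologyZeroAddEquiv_sigmaHigher_zero`, `hodgeCohomologyOneAddEquiv_sigmaHigher_one` to `σ_0`, `σ_1`.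
This file records the SOURCE'S statement: Perry's hypothesis is semiregularity in the sense of
[Perry2026Semiregularity, Def. 2.4] — "`E` is semiregular if `σ²_E : Ext²(E, E) → HH_{-2}(𝒞)` is
injective" — which for `𝒞 = D_perf(X)` "can be identified (after applying an HKR isomorphism) with the
semiregularity map of Buchweitz and Flenner" [loc. cit., Rem. 2.5], `HH_{-2}(X) = ⊕_q H^{q+2}(X, Ω^q)`:
the WHOLE map `σ = (σ_q)_{q ≥ 0}` is injective, i.e. `IsISemiregular hE₀ Set.univ` (BF Def. 4.1 carries the
scalars `(-1)^q/q!`, immaterial for kernels over `ℂ`, see the normalisation note of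
`SemiregularityHigherSigma`). So:

* `Perry2026_semiregularFull_remainsAlgebraic` — verbatim `Perry2026_semiregular_remainsAlgebraic` with
  `IsZeroOneSemiregular hE₀` replaced by `IsISemiregular hE₀ Set.univ` (NAMED FACT, `[claim]`-tagged like
  its `{0,1}` sibling: the source is an April 2026 preprint);
* `isISemiregular_univ_of_isZeroOneSemiregular` (PROVED): `{0,1}`-semiregular ⟹ semiregular, through the
  two comparisons — so the new fact has the WEAKER hypothesis on `E_0`, i.e. it is the STRONGER statement;
* `Perry2026_semiregular_remainsAlgebraic_of_full` (PROVED): the `{0,1}` rendering follows from this one.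

Why it matters (consumer): the line `quaternionic-norm-anchors` of crux `HeckePrymWeil.WeilTenfoldsSqrtMinus11`
(stmt-HodgeConjecture-1262) transports a Weil-pure Chern character from a CM / tensor fibre of Deligne's Weil
family; for DIRECT SUMS of line bundles on an abelian `g`-fold the `{0,1}`-form caps the number of
constituents by `(h^{0,2} + h^{1,3})/h^{0,2}` (`= 27` for `g = 10`) whereas the full map caps it by
`Σ_q h^{q,q+2}/h^{0,2}` (`= 2799`), and the pure designs found there need hundreds of constituents
(`Cruxes/WeilTenfoldsSqrtMinus11/TensorAnchorDesign.md`). No definition of a new notion is made here.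

## References

* [Perry2026Semiregularity] A. Perry, *The semiregularity theorem for equivariant noncommutative varieties*,
  arXiv:2604.00511 (2026), Thm. 1.1 (2), Thm. 6.1, Def. 2.4, Rem. 2.5, §1.3.
* [BuchweitzFlenner2003] R.-O. Buchweitz, H. Flenner, *A semiregularity map for modules and applications to
  deformations*, Compositio Math. 137 (2003), Def. 4.1, §5 (`I`-semiregular), Thm. 5.1.
-/

noncomputable section

open CategoryTheory AlgebraicGeometry
open Literature.AlgebraicTopology.SingularHomology

namespace Literature.AlgebraicGeometry.HodgeTheory

universe w u

/-- **`{0,1}`-semiregular sheaves are semiregular**: if the part `(σ_0, σ_1)` of the Buchweitz–Flenner map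
is injective then so is the whole family `(σ_q)_{q ≥ 0}` (indeed `(σ_q)_{q ∈ I}` for every `I ⊇ {0,1}`):
`σ_0`, `σ_1` of `SemiregularityHigherSigma` are `sigmaZero`, `sigmaOne` of `AtiyahClassTraceReal` under the
additive equivalences `hodgeCohomologyZeroAddEquiv`, `hodgeCohomologyOneAddEquiv`.
[cite: BuchweitzFlenner2003, §5 (I-semiregular)] -/
theorem isISemiregular_univ_of_isZeroOneSemiregular {S : Type u} [CommRing S]
    {X : Over (Spec (CommRingCat.of S))} [HasExt.{w} X.left.Modules] {E : X.left.Modules}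
    (hE : Motives.IsFiniteLocallyFree E) (h : IsZeroOneSemiregular.{w} hE) :
    IsISemiregular.{w} hE Set.univ := by
  intro x hx
  refine (isZeroOneSemiregular_iff hE).1 h x ?_ ?_
  · rw [← hodgeCohomologyZeroAddEquiv_sigmaHigher_zero hE x, hx 0 (Set.mem_univ _), map_zero]
  · rw [← hodgeCohomologyOneAddEquiv_sigmaHigher_one hE x, hx 1 (Set.mem_univ _), map_zero]

/-- **Perry 2026, Thm. 1.1 (2) (the Chern character of a SEMIREGULAR sheaf remains algebraic along a smooth
proper family over a complex variety), case `B_0 = 0`, `E_0` finite locally free — with semiregularity in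
the sense of the source.** Printed: "Let `f : X → S` be a smooth proper family of complex varieties. Let
`0 ∈ S(ℂ)` be a point and let `E_0 ∈ D_perf(X_0)` be a semiregular perfect complex with
`Ext^{<0}(E_0, E_0) = 0`. Assume that `B_0 ∈ H²(X_0, ℚ(1))` is an algebraic class such that
`w_0 = exp(B_0) · ch(E_0)` […] remains Hodge along `S`, i.e. lifts to a global section `w` of the local system
`⊕_{k ≥ 0} R^{2k}f_*ℚ(k)`. Then […] (2) The class `w_0` remains algebraic along `S`", where (Def. 2.4) "`E` is
semiregular if `σ²_E : Ext²(E, E) → HH_{-2}(𝒞)` is injective", a map which for `D_perf(X)` "can be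
identified (after applying an HKR isomorphism) with the semiregularity map of Buchweitz and Flenner"
(Rem. 2.5), `HH_{-2}(X) = ⊕_q H^{q+2}(X, Ω^q)`. Rendering: exactly that of
`Perry2026_semiregular_remainsAlgebraic` (module docstring of `SemiregularVariationalHodge.lean`: smooth
projective family of relative dimension `n` over a smooth integral quasi-projective `ℂ`-scheme, continuous
Hodge-locus-valued sections `w_k` of the étalé spaces of `R^{2k}π_*ℂ`, `w_k(s₀) = ch_k(E_0)` in a Chern
character theory `C`) with the hypothesis on `E_0` being FULL semiregularity, `IsISemiregular hE₀ Set.univ`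
(every `σ_q = Tr(· ∘ At^q)`, `SemiregularityHigherSigma.sigmaHigher`, jointly injective; BF's scalars
`(-1)^q/q!` do not change kernels over `ℂ`). It implies the `{0,1}` rendering
(`Perry2026_semiregular_remainsAlgebraic_of_full`).
[claim: Perry2026Semiregularity, status: under-review] -/
def Perry2026_semiregularFull_remainsAlgebraic : Prop :=
  ∀ (C : ChernCharacterBetti) ⦃𝒳 S : Motives.SchemeOver ℂ⦄ (π : 𝒳 ⟶ S) (n : ℕ),
    Motives.IsSmoothProjectiveFamily π n → IsQuasiProjectiveOver S → IsIntegral S.left →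
    _root_.AlgebraicGeometry.Smooth S.hom →
    ∀ (w : ∀ (k : ℕ) (s : Motives.ComplexPoints S), complexBetti (Motives.fiberOver π s) (2 * k)),
      (∀ k, Continuous fun s => (⟨s, w k s⟩ : FiberClass π (2 * k))) →
      (∀ k s, (⟨s, w k s⟩ : FiberClass π (2 * k)) ∈ locusOfHodgeClasses π n k) →
      ∀ (s₀ : Motives.ComplexPoints S) (E₀ : (Motives.fiberOver π s₀).left.Modules)
        (hE₀ : Motives.IsFiniteLocallyFree E₀), IsISemiregular hE₀ Set.univ →
        (∀ k, w k s₀ = C.ch (Motives.fiberOver π s₀) E₀ k) →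
        ∀ (s : Motives.ComplexPoints S) (k : ℕ), w k s ∈ algebraicClasses (Motives.fiberOver π s) k

/-- **The `{0,1}` rendering follows from the source's statement**: a `{0,1}`-semiregular `E_0` is
semiregular (`isISemiregular_univ_of_isZeroOneSemiregular`), so `Perry2026_semiregularFull_remainsAlgebraic`
implies `Perry2026_semiregular_remainsAlgebraic`. [claim: Perry2026Semiregularity, status: under-review] -/
theorem Perry2026_semiregular_remainsAlgebraic_of_full (h : Perry2026_semiregularFull_remainsAlgebraic) :
    Perry2026_semiregular_remainsAlgebraic :=
  fun C _ _ π n hπ hq hi hs w hwc hwH s₀ E₀ hE₀ hsr hw₀ s k =>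
    h C π n hπ hq hi hs w hwc hwH s₀ E₀ hE₀ (isISemiregular_univ_of_isZeroOneSemiregular hE₀ hsr) hw₀ s k

/-- **The degree-`k` instance of the conclusion** (consumer shape). [claim: Perry2026Semiregularity, status: under-review] -/
theorem Perry2026_semiregularFull_remainsAlgebraic.apply (hP : Perry2026_semiregularFull_remainsAlgebraic)
    (C : ChernCharacterBetti) {𝒳 S : Motives.SchemeOver ℂ} (π : 𝒳 ⟶ S) (n : ℕ)
    (hπ : Motives.IsSmoothProjectiveFamily π n) (hS : IsQuasiProjectiveOver S) (hSi : IsIntegral S.left)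
    (hSs : _root_.AlgebraicGeometry.Smooth S.hom)
    (w : ∀ (k : ℕ) (s : Motives.ComplexPoints S), complexBetti (Motives.fiberOver π s) (2 * k))
    (hwc : ∀ k, Continuous fun s => (⟨s, w k s⟩ : FiberClass π (2 * k)))
    (hwH : ∀ k s, (⟨s, w k s⟩ : FiberClass π (2 * k)) ∈ locusOfHodgeClasses π n k)
    (s₀ : Motives.ComplexPoints S) (E₀ : (Motives.fiberOver π s₀).left.Modules)
    (hE₀ : Motives.IsFiniteLocallyFree E₀) (hsr : IsISemiregular hE₀ Set.univ)
    (hw₀ : ∀ k, w k s₀ = C.ch (Motives.fiberOver π s₀) E₀ k) (s : Motives.ComplexPoints S) (k : ℕ) :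
    w k s ∈ algebraicClasses (Motives.fiberOver π s) k :=
  hP C π n hπ hS hSi hSs w hwc hwH s₀ E₀ hE₀ hsr hw₀ s k

end Literature.AlgebraicGeometry.HodgeTheory

end
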